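import Mathlib
import Summits.ValiantsHypothesis.ValiantsHypothesis.Theses.ValuativeGCT
import Summits.ValiantsHypothesis.ValiantsHypothesis.Theorems.CutBites.Negative.NormalOrderParityLaw

/-!
# `CutBites` — negative lemma: NO JUMP OF THE `Λ_m`-FILTRATION AT THE WRONG PARITY

Crux `stmt-ValiantsHypothesis-12626` (`Theses.ValuativeGCT.CutBites`, route ValuativeGCT).  Standing
disprover (cdisprove gen 3), `Cruxes/CutBites/Disproof.lean` §G.2: the `let`-block corollaries of
`NormalOrderParityLaw` for the crux's truncation `T t` (degree `mδ`, skew locus, every weight):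

* `cutBites_trunc_succ_eq_of_odd_add` — `T (t + 1) = T t` whenever `t + mδ` is odd (every `m`, `δ`, `t`,
  `λ`): the valuative filtration `T 0 ⊇ T 1 ⊇ ⋯` jumps only at thresholds `t ≡ mδ (mod 2)`
  (`NoCutInOddDegree` is `t = 0`, `EvenDegreeOrderParity` is `t = 1`).
* `cutBites_trunc_eq_pred_of_odd` — for ODD `m` and ODD `δ` the crux's own threshold `δ` is not a jump:
  `T δ = T (δ - 1)`; `cutBites_trunc_even_degree_odd_threshold` / `cutBites_trunc_odd_degree_even_threshold`
  — `T (2k+2) = T (2k+1)` when `mδ` is even, `T (2k+1) = T (2k)` when `mδ` is odd.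
[folklore]
-/

namespace Summit.ValiantsHypothesis.ValiantsHypothesis.Theorems.CutBites.Negative

open Literature.NumberTheory.DiophantineGeometry Literature.Computability.AlgebraicComplexity
open MvPolynomial
open scoped BigOperators Matrix

noncomputable section

/-- Lattice bookkeeping: if every element of `Hom ⊓ S` lying in `P^t` lies in `P^(t+1)`, thresholds
`t + 1` and `t` agree. [folklore] -/
theorem inf_pow_succ_eq_inf_pow {σ : Type*} (Hom S W : Submodule ℂ (MvPolynomial σ ℂ))
    (P : Ideal (MvPolynomial σ ℂ)) (t : ℕ) (h : ∀ G ∈ Hom, G ∈ S → G ∈ P ^ t → G ∈ P ^ (t + 1)) :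
    Hom ⊓ (P ^ (t + 1)).restrictScalars ℂ ⊓ S ⊓ W = Hom ⊓ (P ^ t).restrictScalars ℂ ⊓ S ⊓ W := by
  ext G
  simp only [Submodule.mem_inf, Submodule.restrictScalars_mem]
  constructor
  · rintro ⟨⟨⟨hH, hP⟩, hS⟩, hW⟩
    exact ⟨⟨⟨hH, (Ideal.pow_le_pow_right (Nat.le_succ t)) hP⟩, hS⟩, hW⟩
  · rintro ⟨⟨⟨hH, hP⟩, hS⟩, hW⟩
    exact ⟨⟨⟨hH, h G hH hS hP⟩, hS⟩, hW⟩

/-- **No jump at the wrong parity.**  For every `m`, `δ`, `λ` and every threshold `t` with `t + mδ` odd,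
the crux's truncation (its `let`-blocks verbatim) has `T (t + 1) = T t`. [folklore] -/
theorem cutBites_trunc_succ_eq_of_odd_add (m δ t : ℕ) (hpar : Odd (t + m * δ))
    (lam : Nat.Partition (m * δ)) :
    (let U : Submodule ℂ (MatIdx m → ℂ) :=
        Submodule.span ℂ {u : MatIdx m → ℂ | ∀ a b : Fin m, u (toLex (a, b)) = -u (toLex (b, a))};
      let χ : Weight (MatIdx m) := (Weight.dualOfPartition (m * m) lam).toMatIdx;
      let T : ℕ → Submodule ℂ (MvPolynomial (MatIdx m × MatIdx m) ℂ) := fun t =>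
        MvPolynomial.homogeneousSubmodule (MatIdx m × MatIdx m) ℂ (m * δ)
        ⊓ ((MvPolynomial.vanishingIdeal ℂ {p : MatIdx m × MatIdx m → ℂ |
              ∀ j : MatIdx m, (fun i => p (j, i)) ∈ U}) ^ (t)).restrictScalars ℂ
        ⊓ (⨅ (M : Matrix (MatIdx m) (MatIdx m) ℂ)
            (_ : linSubst (MatIdx m) ℂ M (detFormLex ℂ m) = detFormLex ℂ m),
            LinearMap.ker ((MvPolynomial.aeval (R := ℂ) fun p : MatIdx m × MatIdx m =>
              ∑ l : MatIdx m, M l p.2 • MvPolynomial.X (p.1, l)).toLinearMap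
              - LinearMap.id (R := ℂ) (M := MvPolynomial (MatIdx m × MatIdx m) ℂ)))
        ⊓ (⨅ (g : Matrix.GeneralLinearGroup (MatIdx m) ℂ) (_ : IsUpperTriangular g),
            LinearMap.ker ((MvPolynomial.aeval (R := ℂ) fun p : MatIdx m × MatIdx m =>
              ∑ l : MatIdx m, ((g⁻¹ : Matrix.GeneralLinearGroup (MatIdx m) ℂ) :
                Matrix (MatIdx m) (MatIdx m) ℂ) p.1 l • MvPolynomial.X (l, p.2)).toLinearMap
              - weightChar χ g • LinearMap.id (R := ℂ) (M := MvPolynomial (MatIdx m × MatIdx m) ℂ)));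
      T (t + 1) = T t) := by
  intro U χ T
  refine inf_pow_succ_eq_inf_pow _ _ _ _ t fun G hGh hGs hGP => ?_
  have hGs' := (Submodule.mem_iInf _).mp ((Submodule.mem_iInf _).mp hGs
    (Matrix.of fun l i : MatIdx m => if l = toLex ((ofLex i).2, (ofLex i).1) then (1 : ℂ) else 0))
    (linSubst_swapMatrix_detFormLex m)
  rw [LinearMap.mem_ker, LinearMap.sub_apply, sub_eq_zero] at hGs'
  exact mem_vanishingIdeal_pow_succ_of_odd_add_of_rowTranspose_invariant hpar
    ((mem_homogeneousSubmodule _ _).mp hGh) hGs' hGP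

/-- **For odd `m` and odd `δ` the threshold `δ` itself is not a jump**: `T δ = T (δ - 1)`. [folklore] -/
theorem cutBites_trunc_eq_pred_of_odd (m δ : ℕ) (hm : Odd m) (hδ : Odd δ) (lam : Nat.Partition (m * δ)) :
    (let U : Submodule ℂ (MatIdx m → ℂ) :=
        Submodule.span ℂ {u : MatIdx m → ℂ | ∀ a b : Fin m, u (toLex (a, b)) = -u (toLex (b, a))};
      let χ : Weight (MatIdx m) := (Weight.dualOfPartition (m * m) lam).toMatIdx;
      let T : ℕ → Submodule ℂ (MvPolynomial (MatIdx m × MatIdx m) ℂ) := fun t =>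
        MvPolynomial.homogeneousSubmodule (MatIdx m × MatIdx m) ℂ (m * δ)
        ⊓ ((MvPolynomial.vanishingIdeal ℂ {p : MatIdx m × MatIdx m → ℂ |
              ∀ j : MatIdx m, (fun i => p (j, i)) ∈ U}) ^ (t)).restrictScalars ℂ
        ⊓ (⨅ (M : Matrix (MatIdx m) (MatIdx m) ℂ)
            (_ : linSubst (MatIdx m) ℂ M (detFormLex ℂ m) = detFormLex ℂ m),
            LinearMap.ker ((MvPolynomial.aeval (R := ℂ) fun p : MatIdx m × MatIdx m =>
              ∑ l : MatIdx m, M l p.2 • MvPolynomial.X (p.1, l)).toLinearMap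
              - LinearMap.id (R := ℂ) (M := MvPolynomial (MatIdx m × MatIdx m) ℂ)))
        ⊓ (⨅ (g : Matrix.GeneralLinearGroup (MatIdx m) ℂ) (_ : IsUpperTriangular g),
            LinearMap.ker ((MvPolynomial.aeval (R := ℂ) fun p : MatIdx m × MatIdx m =>
              ∑ l : MatIdx m, ((g⁻¹ : Matrix.GeneralLinearGroup (MatIdx m) ℂ) :
                Matrix (MatIdx m) (MatIdx m) ℂ) p.1 l • MvPolynomial.X (l, p.2)).toLinearMap
              - weightChar χ g • LinearMap.id (R := ℂ) (M := MvPolynomial (MatIdx m × MatIdx m) ℂ)));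
      T δ = T (δ - 1)) := by
  intro U χ T
  obtain ⟨k, hk⟩ := hδ
  obtain ⟨j, hj⟩ := hm.mul (⟨k, hk⟩ : Odd δ)
  have h1 : δ = (δ - 1) + 1 := by omega
  have hpar : Odd ((δ - 1) + m * δ) := ⟨k + j, by omega⟩
  have key : T ((δ - 1) + 1) = T (δ - 1) := cutBites_trunc_succ_eq_of_odd_add m δ (δ - 1) hpar lam
  rw [← h1] at key
  exact key

/-- `T (2k + 2) = T (2k + 1)` when `mδ` is even. [folklore] -/
theorem cutBites_trunc_even_degree_odd_threshold (m δ k : ℕ) (h : Even (m * δ))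
    (lam : Nat.Partition (m * δ)) :
    (let U : Submodule ℂ (MatIdx m → ℂ) :=
        Submodule.span ℂ {u : MatIdx m → ℂ | ∀ a b : Fin m, u (toLex (a, b)) = -u (toLex (b, a))};
      let χ : Weight (MatIdx m) := (Weight.dualOfPartition (m * m) lam).toMatIdx;
      let T : ℕ → Submodule ℂ (MvPolynomial (MatIdx m × MatIdx m) ℂ) := fun t =>
        MvPolynomial.homogeneousSubmodule (MatIdx m × MatIdx m) ℂ (m * δ)
        ⊓ ((MvPolynomial.vanishingIdeal ℂ {p : MatIdx m × MatIdx m → ℂ |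
              ∀ j : MatIdx m, (fun i => p (j, i)) ∈ U}) ^ (t)).restrictScalars ℂ
        ⊓ (⨅ (M : Matrix (MatIdx m) (MatIdx m) ℂ)
            (_ : linSubst (MatIdx m) ℂ M (detFormLex ℂ m) = detFormLex ℂ m),
            LinearMap.ker ((MvPolynomial.aeval (R := ℂ) fun p : MatIdx m × MatIdx m =>
              ∑ l : MatIdx m, M l p.2 • MvPolynomial.X (p.1, l)).toLinearMap
              - LinearMap.id (R := ℂ) (M := MvPolynomial (MatIdx m × MatIdx m) ℂ)))
        ⊓ (⨅ (g : Matrix.GeneralLinearGroup (MatIdx m) ℂ) (_ : IsUpperTriangular g),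
            LinearMap.ker ((MvPolynomial.aeval (R := ℂ) fun p : MatIdx m × MatIdx m =>
              ∑ l : MatIdx m, ((g⁻¹ : Matrix.GeneralLinearGroup (MatIdx m) ℂ) :
                Matrix (MatIdx m) (MatIdx m) ℂ) p.1 l • MvPolynomial.X (l, p.2)).toLinearMap
              - weightChar χ g • LinearMap.id (R := ℂ) (M := MvPolynomial (MatIdx m × MatIdx m) ℂ)));
      T (2 * k + 2) = T (2 * k + 1)) := by
  intro U χ T
  obtain ⟨j, hj⟩ := h
  exact cutBites_trunc_succ_eq_of_odd_add m δ (2 * k + 1) ⟨k + j, by omega⟩ lam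

/-- `T (2k + 1) = T (2k)` when `mδ` is odd. [folklore] -/
theorem cutBites_trunc_odd_degree_even_threshold (m δ k : ℕ) (h : Odd (m * δ))
    (lam : Nat.Partition (m * δ)) :
    (let U : Submodule ℂ (MatIdx m → ℂ) :=
        Submodule.span ℂ {u : MatIdx m → ℂ | ∀ a b : Fin m, u (toLex (a, b)) = -u (toLex (b, a))};
      let χ : Weight (MatIdx m) := (Weight.dualOfPartition (m * m) lam).toMatIdx;
      let T : ℕ → Submodule ℂ (MvPolynomial (MatIdx m × MatIdx m) ℂ) := fun t =>
        MvPolynomial.homogeneousSubmodule (MatIdx m × MatIdx m) ℂ (m * δ)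
        ⊓ ((MvPolynomial.vanishingIdeal ℂ {p : MatIdx m × MatIdx m → ℂ |
              ∀ j : MatIdx m, (fun i => p (j, i)) ∈ U}) ^ (t)).restrictScalars ℂ
        ⊓ (⨅ (M : Matrix (MatIdx m) (MatIdx m) ℂ)
            (_ : linSubst (MatIdx m) ℂ M (detFormLex ℂ m) = detFormLex ℂ m),
            LinearMap.ker ((MvPolynomial.aeval (R := ℂ) fun p : MatIdx m × MatIdx m =>
              ∑ l : MatIdx m, M l p.2 • MvPolynomial.X (p.1, l)).toLinearMap
              - LinearMap.id (R := ℂ) (M := MvPolynomial (MatIdx m × MatIdx m) ℂ)))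
        ⊓ (⨅ (g : Matrix.GeneralLinearGroup (MatIdx m) ℂ) (_ : IsUpperTriangular g),
            LinearMap.ker ((MvPolynomial.aeval (R := ℂ) fun p : MatIdx m × MatIdx m =>
              ∑ l : MatIdx m, ((g⁻¹ : Matrix.GeneralLinearGroup (MatIdx m) ℂ) :
                Matrix (MatIdx m) (MatIdx m) ℂ) p.1 l • MvPolynomial.X (l, p.2)).toLinearMap
              - weightChar χ g • LinearMap.id (R := ℂ) (M := MvPolynomial (MatIdx m × MatIdx m) ℂ)));
      T (2 * k + 1) = T (2 * k)) := by
  intro U χ T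
  obtain ⟨j, hj⟩ := h
  exact cutBites_trunc_succ_eq_of_odd_add m δ (2 * k) ⟨k + j, by omega⟩ lam

end

end Summit.ValiantsHypothesis.ValiantsHypothesis.Theorems.CutBites.Negative
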